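import Summits.BirchSwinnertonDyer.BirchSwinnertonDyer.Theorems.PrintCFramBottomClassIndexLawFiveLeKrizLiLocusKolyvagin
import HarnessLib

/-!
# Route `PrintCFram`, crux C2 `BottomClassIndexLawFiveLe` (stmt-BirchSwinnertonDyer-20372), line `eisenstein-resource-bdp-line`:
# the v7 END STATE — the crux BY NAME from prints, Kriz–Li Thm. 1.20, ONE finite-level Kolyvagin inequality on the class, and
# the Eisenstein ♭-inclusion β1 only OFF the Kriz–Li locus

Cell `bsd-print-cfram`, LEAD seat `bsd-line-cfram-p1` (generation g6), `--supports stmt-BirchSwinnertonDyer-20372` (helper); sequel of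
`…KrizLiLocusKolyvagin` (§§1–2: the LOWER index half on the Kriz–Li locus from print; `BSD_p` there from the UPPER half alone).
HONEST FRAMING. The crux C2 is CLASS-WIDE and stays OPEN; no definition, no named fact, no `sorry`; every theorem is CONDITIONAL on
the displayed published facts and on the two RESEARCH statements of the reshaped skeleton v7 — the finite-level Kolyvagin UPPER
inequality on the class (verbatim the signature of `BorelHeegnerSqueeze.stub_kolyvaginUpper_borelCM` of the published line
`borel_heegner_squeeze`, bsd-idea-7 g4) and β1 restricted to the members with NO Kriz–Li datum. BSD is not proved by any of this; no
summit statement is proved by this seat.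

* §3 `bsdp_cmRamified_of_flatIncl_of_indexUpper` / `ramifiedCMBottomClassIndexLawAtZp_of_flatIncl_of_indexUpper` — for ANY class
  member: β1 at the Heegner data of `W` (v3 form; its torsion hypothesis is discharged from exact control at `𝔭′`) gives the LOWER
  index half (`indexLowerBoundLeAt_of_flatInclLe_of_control`; Hsieh + LZZ for the frame value), the Kolyvagin inequality the UPPER
  half, Burungale–Flach the rank-zero CM partner, and the row theorem `bsdp_of_indexHalves_of_twist_row` (Friedberg–Hoffstein datum
  from `ToricPublishedInputs`) gives `BSD_p(W)`. The analytic stub (AN) of v4–v6 and the PRINT stub `stub_residualCharacterSelmerFinite`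
  are not used.
* §4 `bottomClassIndexLawFiveLe_of_prints7_of_krizLi_of_kolyvaginUpper_of_flatInclOffKrizLi` — the v7 END STATE (pointwise in `W`:
  Kriz–Li datum ⟹ `…KrizLiLocusKolyvagin` §2; no Kriz–Li datum ⟹ §3).

References: [JetchevSkinnerWan2017] §7.4.1; [KrizLi2019] Thm. 1.20; [Kolyvagin1990] Thm. A; [Jetchev2008] Thm. 1.4;
[GrigorovJorzaPatrikisSteinTarnita2009] Thm. 3.7; [BurungaleFlach2024] Cor. 2; [Hsieh2014] Thm. A; [LiuZhangZhang2018] Thm. 1.5.1/1.5.3;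
[FriedbergHoffstein1995] Thm. B; [Cassels1965ArithmeticVIII].
-/

set_option autoImplicit false
-- the summit namespace `Summit.BirchSwinnertonDyer.BirchSwinnertonDyer` repeats the problem name by design (D-0017)
set_option linter.dupNamespace false

noncomputable section

open scoped Classical

namespace Summit.BirchSwinnertonDyer.BirchSwinnertonDyer.Theorems.PrintCFram.KrizLiKolyvagin

open WeierstrassCurve NumberField IsDedekindDomain Field PowerSeries
  Literature.NumberTheory.EllipticCurves Literature.NumberTheory.EllipticCurves.GreenbergSelmer
  Literature.NumberTheory.EllipticCurves.GreenbergVatsal2000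
  Literature.NumberTheory.EllipticCurves.ModularForms
  Literature.NumberTheory.EllipticCurves.KrizLi2019
  Literature.NumberTheory.GaloisCohomology
  Literature.NumberTheory.EllipticCurves.Rank1Residual
  Literature.NumberTheory.EllipticCurves.Rank1Residual.Typed
  Literature.NumberTheory.GaloisRepresentations
  Summit.BirchSwinnertonDyer.Rank1Residual
  Summit.BirchSwinnertonDyer.Rank1Residual.Additive
  Summit.BirchSwinnertonDyer.Rank1Residual.X11b Summit.BirchSwinnertonDyer.Rank1Residual.X11b.AcSelmer
  Summit.BirchSwinnertonDyer.Rank1Residual.X11b.Halves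
  Summit.BirchSwinnertonDyer.Rank1Residual.X12
  Summit.BirchSwinnertonDyer.Rank1Residual.X2.ResidualDevissageModules
  Summit.BirchSwinnertonDyer.BirchSwinnertonDyer.Theses.UniversalToricDescent
  Summit.BirchSwinnertonDyer.BirchSwinnertonDyer.Theorems
  Summit.BirchSwinnertonDyer.BirchSwinnertonDyer.Theorems.SchneiderFree
  Summit.BirchSwinnertonDyer.BirchSwinnertonDyer.Theorems.UniversalToricDescentWaldspurgerFlat
  Summit.BirchSwinnertonDyer.BirchSwinnertonDyer.Theorems.UniversalToricDescentStrictPlace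
  Summit.BirchSwinnertonDyer.BirchSwinnertonDyer.Theorems.RamifiedSevenEllipticUnits
  Summit.BirchSwinnertonDyer.BirchSwinnertonDyer.Theorems.PrintCFram
  Summit.BirchSwinnertonDyer.BirchSwinnertonDyer.Theorems.PrintCFram.EisensteinResourceBdpLine

/-! ## §3 Any class member: `BSD_p(W)` from the Eisenstein ♭-inclusion (LOWER) and the Kolyvagin inequality (UPPER) -/

section OffLocus

variable {p : ℕ} [Fact p.Prime]

/-- **`BSD_p(W)` for ANY member of the CM-ramified class from the ♭-(∅,0) Eisenstein inclusion β1 at the Heegner data of `W`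
(LOWER half, through `indexLowerBoundLeAt_of_flatInclLe_of_control` — Hsieh + LZZ for the ♭-frame value, exact control of the
class at `𝔭′`, which also discharges β1's torsion hypothesis) and the finite-level Kolyvagin inequality at the Heegner data of `W`
with `d_K` odd `< −4` (UPPER half), the rank-zero CM partner by Burungale–Flach, and the row theorem `bsdp_of_indexHalves_of_twist_row`
(its Friedberg–Hoffstein datum comes from `ToricPublishedInputs`). Neither the analytic stub (AN) of v4–v6 nor CGLS Prop. 14 is used.
CONDITIONAL on the seven citations and the two displayed research hypotheses. [cite: JetchevSkinnerWan2017, §7.4.1 (arXiv:1512.06894 p. 30)]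
[cite: Hsieh2014, Thm. A p. 712 (Doc. Math. 19)] [cite: LiuZhangZhang2018, Thm 1.5.1 and Thm 1.5.3 (Duke Math. J. 167 pp. 748–749)]
[cite: FriedbergHoffstein1995, Thm. B] [cite: BurungaleFlach2024, Thm. 1.1 and Cor. 2] [cite: Jetchev2008, Thm. 1.4] -/
theorem bsdp_cmRamified_of_flatIncl_of_indexUpper
    (hprints : Hsieh2014.thmA_exists_isHsiehLFunction_unrPeriod_anyLevel ∧
      LiuZhangZhang2018.thm151_thm153_modularCurve_heegnerVector_additive ∧
      ToricPublishedInputs ∧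
      (∀ (K : Type) [Field K] [NumberField K], poitouTate_sha_tateDual K) ∧
      bsdTriple_of_hasCM_of_L_one_ne_zero ∧ hasEntireLFunction_rat ∧ bsdRHS_eq_of_isIsogenous)
    (W : WeierstrassCurve ℚ) [W.IsElliptic] [W.IsGloballyMinimal] (hCM : W.HasCM) (hram : CMRamified W p) (h5 : 5 ≤ p)
    (hr : W.analyticRank = 1)
    -- β1 at the Heegner data of `W` (v3 form, with the torsion hypothesis)
    (hIncl : ∀ (N : ℕ) [NeZero N] (K : Type) [Field K] [NumberField K] (Dt : ModularParametrizationData W N),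
      W.conductorNorm ℤ = N → IsImaginaryQuadratic K → SatisfiesHeegnerHypothesis N K →
      ∀ (κ : ZpExtension K p), κ.IsAnticyclotomic → ∀ (γ : Field.absoluteGaloisGroup K) [Fact (κ.IsTopGenerator γ)]
        (𝔭 : HeightOneSpectrum (𝓞 K)), ((p : ℕ) : 𝓞 K) ∈ 𝔭.asIdeal → 𝔭.asIdeal.ramificationIdx (𝓞 ℚ) = 1 →
        𝔭.asIdeal.inertiaDeg (𝓞 ℚ) = 1 → ∀ (𝔭' : HeightOneSpectrum (𝓞 K)), ((p : ℕ) : 𝓞 K) ∈ 𝔭'.asIdeal → 𝔭' ≠ 𝔭 →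
        ∀ (ι' : PadicAlgCl p ≃+* ℂ), SchneiderFree.BranchInducesPrime p ι' 𝔭 →
        ∀ (ΩK : ℂ) (Ωp : ℂ_[p]) (Q : PowerSeries (PadicComplexInt p)), ΩK ≠ 0 → Ωp ≠ 0 →
          R1.IsBDPLFunctionInt p ι' 𝔭 κ γ Dt.f ΩK Ωp Q →
          Module.IsTorsion (IwasawaAlgebra p) (XAc (W.baseChange K) p κ 𝔭' ∅ γ) →
          (XAc.charIdeal (W.baseChange K) p κ 𝔭' ∅ γ).map (PowerSeries.map (R1.toCpInt p)) ≤ Ideal.span {Q})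
    -- the finite-level Kolyvagin inequality at the Heegner data of `W`
    (hKoUp : ∀ (N : ℕ) [NeZero N] (K : Type) [Field K] [NumberField K]
        (Dt : ModularParametrizationData W N) (H : HeegnerDatum N (NumberField.discr K)) (ι : K →+* ℂ)
        (P : (W.baseChange K).toAffine.Point),
        W.conductorNorm ℤ = N → IsImaginaryQuadratic K → Odd (NumberField.discr K) →
        ¬ p ∣ Units.torsionOrder K → SatisfiesHeegnerHypothesis N K →
        (W.quadraticTwist (NumberField.discr K : ℚ)).entireLFunction 1 ≠ 0 →
        WeierstrassCurve.Affine.Point.map ι.toRatAlgHom P = heegnerPointComplex Dt H →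
        ¬ IsOfFinAddOrder P →
        Upper.IndexUpperBoundLeAt W p K P (padicValNat p Dt.c.natAbs)) :
    BSDp W p := by
  have hp : p.Prime := Fact.out
  have hp2 : p ≠ 2 := by omega
  obtain ⟨hA, hL, hF, hPT2, hBF, hmod, -⟩ := hprints
  have hKo : ∀ (N : ℕ) [NeZero N] (W : WeierstrassCurve ℚ) (K : Type) [Field K] [NumberField K],
      Literature.NumberTheory.EllipticCurves.kolyvagin N W K := hF.2.1
  obtain ⟨hPT, hEP, hcd, hBr⟩ := EisensteinResourceBdpLine.prints_four_hold
  have hadd : Addv W p := addv_of_cmRamified W hCM hram h5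
  have hpNW : p ∣ W.conductorNorm ℤ := (W.dvd_conductorNorm_iff_not_hasGoodReductionAtPrime p).mpr hadd.1
  -- exact control of the class at every frame of every Heegner datum
  have hCtlW := additiveControl_heegner_of_cmRamified (p := p) hPT hPT2 hEP hcd hBr W hCM hram h5
  refine bsdp_of_indexHalves_of_twist_row p hp2 hF W hadd hr ?_ ?_ (rankZeroTwistBSDp_of_hasCM hBF hmod W hCM)
  · -- LOWER half from β1 + control (torsion at `𝔭′` from control at `𝔭′`)
    intro N _ K _ _ Dt H ι P hN hK hHN _hodd hd4 hLt hP hnt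
    have hpN : p ∣ N := by rw [← hN]; exact hpNW
    exact indexLowerBoundLeAt_of_flatInclLe_of_control hp2 hA hL Dt H ι P hadd hN hK hHN hd4 hP hnt (hKo N W K)
      (fun κ hκ γ _ 𝔭 h𝔭 he hf 𝔭' h𝔭' hne ι' hind ΩK Ωp Q hΩK hΩp hBDP ↦ by
        obtain ⟨he', hf'⟩ := degreeOne_of_dvd_of_heegner hK hHN hpN h𝔭'
        obtain ⟨n, hn, -⟩ := hCtlW N K Dt H ι P hN hK hHN hLt hP hnt (hKo N W K) κ hκ γ 𝔭' h𝔭' he' hf'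
        exact hIncl N K Dt hN hK hHN κ hκ γ 𝔭 h𝔭 he hf 𝔭' h𝔭' hne ι' hind ΩK Ωp Q hΩK hΩp hBDP hn.1)
      (fun κ hκ γ _ 𝔭 h𝔭 he hf ↦ hCtlW N K Dt H ι P hN hK hHN hLt hP hnt (hKo N W K) κ hκ γ 𝔭 h𝔭 he hf)
  · -- UPPER half: the Kolyvagin inequality (`p ∤ #𝓞_K^×` from `d_K < −4`)
    intro N _ K _ _ Dt H ι P hN hK hHN hodd hd4 hLt hP hnt
    have hw : ¬ p ∣ Units.torsionOrder K := by
      rw [Literature.NumberTheory.QuadraticFields.Quadratic.torsionOrder_eq_two_of_discr_lt_neg_four hK.1 hd4]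
      intro h
      exact hp2 ((Nat.prime_dvd_prime_iff_eq hp Nat.prime_two).mp h)
    exact hKoUp N K Dt H ι P hN hK hodd hw hHN hLt hP hnt

/-- **C2's conclusion for ANY class member from β1 at the Heegner data of `W` and the Kolyvagin inequality there**:
`bsdp_cmRamified_of_flatIncl_of_indexUpper` then k7r-c4's `ramifiedCMBottomClassIndexLawAtZp_of_bsdp`. CONDITIONAL.
[cite: JetchevSkinnerWan2017, §7.4.1 (arXiv:1512.06894 p. 30)] [cite: Miller2011LMS, Def. 1.1 (arXiv:1010.2431 p. 3)] -/
theorem ramifiedCMBottomClassIndexLawAtZp_of_flatIncl_of_indexUpper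
    (hprints : Hsieh2014.thmA_exists_isHsiehLFunction_unrPeriod_anyLevel ∧
      LiuZhangZhang2018.thm151_thm153_modularCurve_heegnerVector_additive ∧
      ToricPublishedInputs ∧
      (∀ (K : Type) [Field K] [NumberField K], poitouTate_sha_tateDual K) ∧
      bsdTriple_of_hasCM_of_L_one_ne_zero ∧ hasEntireLFunction_rat ∧ bsdRHS_eq_of_isIsogenous)
    (W : WeierstrassCurve ℚ) [W.IsElliptic] [W.IsGloballyMinimal] (hCM : W.HasCM) (hram : CMRamified W p) (h5 : 5 ≤ p)
    (hr : W.analyticRank = 1)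
    (hIncl : ∀ (N : ℕ) [NeZero N] (K : Type) [Field K] [NumberField K] (Dt : ModularParametrizationData W N),
      W.conductorNorm ℤ = N → IsImaginaryQuadratic K → SatisfiesHeegnerHypothesis N K →
      ∀ (κ : ZpExtension K p), κ.IsAnticyclotomic → ∀ (γ : Field.absoluteGaloisGroup K) [Fact (κ.IsTopGenerator γ)]
        (𝔭 : HeightOneSpectrum (𝓞 K)), ((p : ℕ) : 𝓞 K) ∈ 𝔭.asIdeal → 𝔭.asIdeal.ramificationIdx (𝓞 ℚ) = 1 →
        𝔭.asIdeal.inertiaDeg (𝓞 ℚ) = 1 → ∀ (𝔭' : HeightOneSpectrum (𝓞 K)), ((p : ℕ) : 𝓞 K) ∈ 𝔭'.asIdeal → 𝔭' ≠ 𝔭 →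
        ∀ (ι' : PadicAlgCl p ≃+* ℂ), SchneiderFree.BranchInducesPrime p ι' 𝔭 →
        ∀ (ΩK : ℂ) (Ωp : ℂ_[p]) (Q : PowerSeries (PadicComplexInt p)), ΩK ≠ 0 → Ωp ≠ 0 →
          R1.IsBDPLFunctionInt p ι' 𝔭 κ γ Dt.f ΩK Ωp Q →
          Module.IsTorsion (IwasawaAlgebra p) (XAc (W.baseChange K) p κ 𝔭' ∅ γ) →
          (XAc.charIdeal (W.baseChange K) p κ 𝔭' ∅ γ).map (PowerSeries.map (R1.toCpInt p)) ≤ Ideal.span {Q})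
    (hKoUp : ∀ (N : ℕ) [NeZero N] (K : Type) [Field K] [NumberField K]
        (Dt : ModularParametrizationData W N) (H : HeegnerDatum N (NumberField.discr K)) (ι : K →+* ℂ)
        (P : (W.baseChange K).toAffine.Point),
        W.conductorNorm ℤ = N → IsImaginaryQuadratic K → Odd (NumberField.discr K) →
        ¬ p ∣ Units.torsionOrder K → SatisfiesHeegnerHypothesis N K →
        (W.quadraticTwist (NumberField.discr K : ℚ)).entireLFunction 1 ≠ 0 →
        WeierstrassCurve.Affine.Point.map ι.toRatAlgHom P = heegnerPointComplex Dt H →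
        ¬ IsOfFinAddOrder P →
        Upper.IndexUpperBoundLeAt W p K P (padicValNat p Dt.c.natAbs)) :
    X12.O11.RamifiedCMBottomClassIndexLawAtZp W p := by
  have hpr := hprints
  obtain ⟨-, -, ⟨-, -, hGZK, -⟩, -, -, hmod, hCassels⟩ := hpr
  exact RubinFormulaZpBsdp.ramifiedCMBottomClassIndexLawAtZp_of_bsdp hCassels hmod hGZK hr.le
    (bsdp_cmRamified_of_flatIncl_of_indexUpper hprints W hCM hram h5 hr hIncl hKoUp)

end OffLocus

/-! ## §4 The v7 END STATE of the line: the crux BY NAME from prints, Kriz–Li, the Kolyvagin inequality and β1 off the Kriz–Li locus -/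

section EndState

/-- **END STATE v7 of line `eisenstein-resource-bdp-line`: `BottomClassIndexLawFiveLe` BY NAME from** (i) the seven citations of
`stub_prints`, (ii) Kriz–Li 2019 Thm. 1.20 (`stub_krizLi`), (iii) the finite-level Kolyvagin UPPER inequality on the CM-ramified
class — VERBATIM the signature of the published line `borel_heegner_squeeze`'s stub `stub_kolyvaginUpper_borelCM` (bsd-idea-7 g4),
now the stub `stub_kolyvaginUpper_borelCM` of v7 — and (iv) the ♭-(∅,0) Eisenstein inclusion β1 RESTRICTED to the members WITHOUT a
Kriz–Li datum (`stub_flatEisensteinIncl_cmRamified_offKrizLi`). Pointwise in the curve: at a member with a Kriz–Li datum, §2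
(LOWER from print, UPPER from (iii)); at a member without one, §3 (LOWER from (iv), UPPER from (iii)). The GZK antecedent of the crux
is not used (it sits inside `ToricPublishedInputs`). CONDITIONAL on (i)–(iv); (iii) and (iv) are RESEARCH. BSD is not proved by
any of this. [cite: KrizLi2019, Thm. 1.20 (pp. 7–8), Rem. 1.21 (p. 8)] [cite: GrigorovJorzaPatrikisSteinTarnita2009, Thm. 3.7]
[cite: JetchevSkinnerWan2017, §7.4.1 (arXiv:1512.06894 p. 30)] -/
theorem bottomClassIndexLawFiveLe_of_prints7_of_krizLi_of_kolyvaginUpper_of_flatInclOffKrizLi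
    (hprints : Hsieh2014.thmA_exists_isHsiehLFunction_unrPeriod_anyLevel ∧
      LiuZhangZhang2018.thm151_thm153_modularCurve_heegnerVector_additive ∧
      ToricPublishedInputs ∧
      (∀ (K : Type) [Field K] [NumberField K], poitouTate_sha_tateDual K) ∧
      bsdTriple_of_hasCM_of_L_one_ne_zero ∧ hasEntireLFunction_rat ∧ bsdRHS_eq_of_isIsogenous)
    (hKL : KrizLi2019.thm120_padicLogHeegner_unit_of_bernoulli)
    (hKoUp : ∀ (W : WeierstrassCurve ℚ) [W.IsElliptic] [W.IsGloballyMinimal] (p : ℕ) [Fact p.Prime],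
      W.HasCM → CMRamified W p → 5 ≤ p → W.analyticRank = 1 →
      ∀ (N : ℕ) [NeZero N] (K : Type) [Field K] [NumberField K]
        (Dt : ModularParametrizationData W N) (H : HeegnerDatum N (NumberField.discr K)) (ι : K →+* ℂ)
        (P : (W.baseChange K).toAffine.Point),
        W.conductorNorm ℤ = N → IsImaginaryQuadratic K → Odd (NumberField.discr K) →
        ¬ p ∣ Units.torsionOrder K → SatisfiesHeegnerHypothesis N K →
        (W.quadraticTwist (NumberField.discr K : ℚ)).entireLFunction 1 ≠ 0 →
        WeierstrassCurve.Affine.Point.map ι.toRatAlgHom P = heegnerPointComplex Dt H →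
        ¬ IsOfFinAddOrder P →
        Upper.IndexUpperBoundLeAt W p K P (padicValNat p Dt.c.natAbs))
    (hInclOff : ∀ (p : ℕ) [Fact p.Prime] (W : WeierstrassCurve ℚ) [W.IsElliptic] [W.IsGloballyMinimal],
      W.HasCM → CMRamified W p → 5 ≤ p → W.analyticRank = 1 →
      (¬ ∃ (N : ℕ) (_ : NeZero N) (K : Type) (_ : Field K) (_ : NumberField K) (Dt : ModularParametrizationData W N)
          (H : HeegnerDatum N (NumberField.discr K)) (ι : K →+* ℂ) (P : (W.baseChange K).toAffine.Point)
          (f : ℕ) (_ : NeZero f) (ψ : DirichletCharacter ℚ_[p] f) (ω : DirichletCharacter ℚ_[p] p)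
          (εK : DirichletCharacter ℚ_[p] (NumberField.discr K).natAbs),
          W.conductorNorm ℤ = N ∧ IsImaginaryQuadratic K ∧ SatisfiesHeegnerHypothesis N K ∧ Odd (NumberField.discr K) ∧
          NumberField.discr K < -4 ∧ (W.quadraticTwist (NumberField.discr K : ℚ)).entireLFunction 1 ≠ 0 ∧
          WeierstrassCurve.Affine.Point.map ι.toRatAlgHom P = heegnerPointComplex Dt H ∧
          ψ.IsPrimitive ∧ KrizLi2019.IsTeichmullerCharacter ω ∧
          (∀ ℓ : ℕ, ℓ.Prime → ¬ (ℓ ∣ p * W.conductorNorm ℤ) →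
            ‖((W.LFunction ℓ : ℤ) : ℚ_[p]) - (ψ (ℓ : ZMod f) + ψ⁻¹ (ℓ : ZMod f) * ω (ℓ : ZMod p))‖ < 1) ∧
          ψ (p : ZMod f) ≠ 1 ∧ KrizLi2019.primVal (KrizLi2019.invMulOmega ψ ω) p ≠ 1 ∧
          (∀ ℓ : ℕ, (hℓ : ℓ.Prime) → ℓ ≠ p →
            (haveI := Fact.mk hℓ; ¬ W.HasGoodReductionAtPrime ℓ ∧ ¬ W.HasMultiplicativeReductionAtPrime ℓ) →
            ψ (ℓ : ZMod f) ≠ 1 ∧ KrizLi2019.primVal (KrizLi2019.invMulOmega ψ ω) ℓ ≠ 1) ∧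
          KrizLi2019.IsKroneckerCharacterOf K εK ∧
          ¬ (‖KrizLi2019.bernoulliOnePrim (KrizLi2019.bernoulliCharOne ψ εK) *
              KrizLi2019.bernoulliOnePrim (KrizLi2019.bernoulliCharTwo ψ εK ω)‖ ≤ (p : ℝ)⁻¹)) →
      ∀ (N : ℕ) [NeZero N] (K : Type) [Field K] [NumberField K] (Dt : ModularParametrizationData W N),
      W.conductorNorm ℤ = N → IsImaginaryQuadratic K → SatisfiesHeegnerHypothesis N K →
      ∀ (κ : ZpExtension K p), κ.IsAnticyclotomic → ∀ (γ : Field.absoluteGaloisGroup K) [Fact (κ.IsTopGenerator γ)]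
        (𝔭 : HeightOneSpectrum (𝓞 K)), ((p : ℕ) : 𝓞 K) ∈ 𝔭.asIdeal → 𝔭.asIdeal.ramificationIdx (𝓞 ℚ) = 1 →
        𝔭.asIdeal.inertiaDeg (𝓞 ℚ) = 1 → ∀ (𝔭' : HeightOneSpectrum (𝓞 K)), ((p : ℕ) : 𝓞 K) ∈ 𝔭'.asIdeal → 𝔭' ≠ 𝔭 →
        ∀ (ι' : PadicAlgCl p ≃+* ℂ), SchneiderFree.BranchInducesPrime p ι' 𝔭 →
        ∀ (ΩK : ℂ) (Ωp : ℂ_[p]) (Q : PowerSeries (PadicComplexInt p)), ΩK ≠ 0 → Ωp ≠ 0 →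
          R1.IsBDPLFunctionInt p ι' 𝔭 κ γ Dt.f ΩK Ωp Q →
          Module.IsTorsion (IwasawaAlgebra p) (XAc (W.baseChange K) p κ 𝔭' ∅ γ) →
          (XAc.charIdeal (W.baseChange K) p κ 𝔭' ∅ γ).map (PowerSeries.map (R1.toCpInt p)) ≤ Ideal.span {Q}) :
    Summit.BirchSwinnertonDyer.BirchSwinnertonDyer.Theses.PrintCFram.BottomClassIndexLawFiveLe := by
  intro _hGZK W _ _ p _ hCM hram h5 hr
  have hp : p.Prime := Fact.out
  have hp2 : p ≠ 2 := by omega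
  by_cases hKLd : ∃ (N : ℕ) (_ : NeZero N) (K : Type) (_ : Field K) (_ : NumberField K) (Dt : ModularParametrizationData W N)
          (H : HeegnerDatum N (NumberField.discr K)) (ι : K →+* ℂ) (P : (W.baseChange K).toAffine.Point)
          (f : ℕ) (_ : NeZero f) (ψ : DirichletCharacter ℚ_[p] f) (ω : DirichletCharacter ℚ_[p] p)
          (εK : DirichletCharacter ℚ_[p] (NumberField.discr K).natAbs),
          W.conductorNorm ℤ = N ∧ IsImaginaryQuadratic K ∧ SatisfiesHeegnerHypothesis N K ∧ Odd (NumberField.discr K) ∧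
          NumberField.discr K < -4 ∧ (W.quadraticTwist (NumberField.discr K : ℚ)).entireLFunction 1 ≠ 0 ∧
          WeierstrassCurve.Affine.Point.map ι.toRatAlgHom P = heegnerPointComplex Dt H ∧
          ψ.IsPrimitive ∧ KrizLi2019.IsTeichmullerCharacter ω ∧
          (∀ ℓ : ℕ, ℓ.Prime → ¬ (ℓ ∣ p * W.conductorNorm ℤ) →
            ‖((W.LFunction ℓ : ℤ) : ℚ_[p]) - (ψ (ℓ : ZMod f) + ψ⁻¹ (ℓ : ZMod f) * ω (ℓ : ZMod p))‖ < 1) ∧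
          ψ (p : ZMod f) ≠ 1 ∧ KrizLi2019.primVal (KrizLi2019.invMulOmega ψ ω) p ≠ 1 ∧
          (∀ ℓ : ℕ, (hℓ : ℓ.Prime) → ℓ ≠ p →
            (haveI := Fact.mk hℓ; ¬ W.HasGoodReductionAtPrime ℓ ∧ ¬ W.HasMultiplicativeReductionAtPrime ℓ) →
            ψ (ℓ : ZMod f) ≠ 1 ∧ KrizLi2019.primVal (KrizLi2019.invMulOmega ψ ω) ℓ ≠ 1) ∧
          KrizLi2019.IsKroneckerCharacterOf K εK ∧
          ¬ (‖KrizLi2019.bernoulliOnePrim (KrizLi2019.bernoulliCharOne ψ εK) *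
              KrizLi2019.bernoulliOnePrim (KrizLi2019.bernoulliCharTwo ψ εK ω)‖ ≤ (p : ℝ)⁻¹)
  · -- ON the Kriz–Li locus: LOWER from print (§1), UPPER from the Kolyvagin inequality at that datum (§2)
    obtain ⟨N, _, K, _, _, Dt, H, ι, P, f, _, ψ, ω, εK, hN, hK, hHN, hodd, hd4, hLt, hP, hψ, hω, hss, h1, h1', h3, hεK, h4⟩ :=
      hKLd
    have hw : ¬ p ∣ Units.torsionOrder K := by
      rw [Literature.NumberTheory.QuadraticFields.Quadratic.torsionOrder_eq_two_of_discr_lt_neg_four hK.1 hd4]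
      intro h
      exact hp2 ((Nat.prime_dvd_prime_iff_eq hp Nat.prime_two).mp h)
    exact ramifiedCMBottomClassIndexLawAtZp_of_krizLiDatum_of_indexUpper hprints hKL W hCM hram h5 hr N K Dt H ι P hN hK hHN hodd
      hd4 hLt hP f ψ ω hψ hω hss h1 h1' h3 εK hεK h4
      (fun hnt ↦ hKoUp W p hCM hram h5 hr N K Dt H ι P hN hK hodd hw hHN hLt hP hnt)
  · -- OFF the Kriz–Li locus: LOWER from β1 (§3), UPPER from the Kolyvagin inequality
    exact ramifiedCMBottomClassIndexLawAtZp_of_flatIncl_of_indexUpper hprints W hCM hram h5 hr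
      (hInclOff p W hCM hram h5 hr hKLd)
      (fun N _ K _ _ Dt H ι P hN hK hodd hw hHN hLt hP hnt ↦ hKoUp W p hCM hram h5 hr N K Dt H ι P hN hK hodd hw hHN hLt hP hnt)

end EndState

end Summit.BirchSwinnertonDyer.BirchSwinnertonDyer.Theorems.PrintCFram.KrizLiKolyvagin

end
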